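import Mathlib

/-!
# `MatrixDescartes` (stmt-ValiantsHypothesis-18050), line `osculation_law`, stub `stub_recursion`, residue R6(a) — the
# SEGMENT ⇒ CLOSURE toolkit for density of a general-position family of pencils

Helper file (`--supports stmt-ValiantsHypothesis-18050 --as helper`; cell val-lit, seat val-port-3 g1, merged desk g12;
route-independent glue for the density hypothesis `hGdense` of `RecursionTransfer.recursion_of_family`
(`…OsculationLawRecursionAssembly`)).  Closes NO item.  Mathlib only; no definitions.

Every density argument on the bus (val-lit-p7 g13's memo `NOTE-p7g13-18050-GP-density-sizing.md` §4, val-lit-p6 g14's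
(D1) `…GPGenericDet`, val-lit-p5 g12's (D2) `…UniformFinite`) has the same last step: along the segment
`S_ε = (1 − ε)•S + ε•W` from a pencil `S` to a general-position WITNESS `W`, each general-position condition fails
only for finitely many `ε` (a nonzero real polynomial in `ε` vanishes there), possibly after choosing an auxiliary
parameter `c` (the shift of the top letter) large and generic; hence `S_ε` is in general position for all small
`ε > 0`, and `S_ε → S`.  This file packages that step once:

* `continuous_segment`, `tendsto_segment` — `ε ↦ (1 − ε)•S + ε•W` is continuous on letter families
  `Fin K → Matrix ι ι ℝ` and tends to `S` as `ε → 0`;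
* **`mem_closure_of_eventually_segment`** — if `S_ε ∈ N` for all small `ε > 0` (`∀ᶠ ε in 𝓝[>] 0`), then
  `S ∈ closure N`;
* **`mem_closure_of_finite_bad`** — if `S_ε ∈ N` for every `ε > 0` outside a FINITE set, then `S ∈ closure N`;
* `eventually_nhdsGT_not_mem_of_finite` — a finite set of reals is eventually avoided as `ε → 0⁺`;
* `finite_setOf_eval_eq_zero` — a nonzero real polynomial has finitely many zeros (Mathlib, restated as a `Set`);
* `finite_setOf_map_eval_eq_zero`, `finite_setOf_eval_eval_eq_zero` — a nonzero BIVARIATE polynomial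
  `R ∈ ℝ[X][X]` (outer variable `c`, coefficients in `ε`): for all but finitely many `ε` the specialisation in `c` is a
  nonzero polynomial, which then has finitely many zeros `c`;
* **`exists_gt_forall_eval_ne_zero`** — finitely many nonzero real polynomials and a threshold `c₀`: some `c > c₀`
  is a non-zero of all of them («choose the shift large and generic»).

[folklore] Point-set topology and finiteness of root sets.  Honest framing: glue only; the general-position density
(R6(a)), the osculation LAW, `MatrixDescartes` (18050) and VP ≠ VNP are NOT proved here.
-/

set_option linter.dupNamespace false

namespace Summit.ValiantsHypothesis.ValiantsHypothesis.Theorems.LacunarySymmetroidMatrixDescartes.GPDensity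

open Polynomial Matrix Filter Topology
open scoped BigOperators

variable {K : ℕ} {ι : Type*}

/-! ## The segment `ε ↦ (1 − ε)•S + ε•W` -/

/-- The segment between two letter families is continuous in the parameter. [folklore] -/
theorem continuous_segment (S W : Fin K → Matrix ι ι ℝ) :
    Continuous fun ε : ℝ => (1 - ε) • S + ε • W := by
  refine continuous_pi fun l => ?_
  refine continuous_matrix fun i j => ?_
  simp only [Pi.add_apply, Pi.smul_apply, Matrix.add_apply, Matrix.smul_apply, smul_eq_mul]
  fun_prop

/-- The segment tends to its left end as `ε → 0`. [folklore] -/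
theorem tendsto_segment (S W : Fin K → Matrix ι ι ℝ) :
    Tendsto (fun ε : ℝ => (1 - ε) • S + ε • W) (𝓝 0) (𝓝 S) := by
  have h := (continuous_segment S W).tendsto 0
  simpa using h

/-- **Segment ⇒ closure, filter form.**  If `(1 − ε)•S + ε•W ∈ N` for all small `ε > 0`, then `S ∈ closure N`.
[folklore] -/
theorem mem_closure_of_eventually_segment (S W : Fin K → Matrix ι ι ℝ) (N : Set (Fin K → Matrix ι ι ℝ))
    (h : ∀ᶠ ε in 𝓝[>] (0 : ℝ), (1 - ε) • S + ε • W ∈ N) : S ∈ closure N :=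
  mem_closure_of_tendsto ((tendsto_segment S W).mono_left nhdsWithin_le_nhds) h

/-- A finite set of reals is avoided by all small `ε > 0`. [folklore] -/
theorem eventually_nhdsGT_not_mem_of_finite {B : Set ℝ} (hB : B.Finite) :
    ∀ᶠ ε in 𝓝[>] (0 : ℝ), ε ∉ B := by
  have h1 : ∀ᶠ ε in 𝓝[>] (0 : ℝ), ε ∉ B \ {0} := by
    have hclosed : IsClosed (B \ {0}) := (hB.subset Set.sdiff_subset).isClosed
    have hmem : (B \ {0})ᶜ ∈ 𝓝 (0 : ℝ) := hclosed.compl_mem_nhds (by simp)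
    exact nhdsWithin_le_nhds hmem
  have h2 : ∀ᶠ ε in 𝓝[>] (0 : ℝ), 0 < ε := eventually_nhdsWithin_of_forall fun ε hε => hε
  filter_upwards [h1, h2] with ε hε hpos
  intro hεB
  exact hε ⟨hεB, by simpa using hpos.ne'⟩

/-- **Segment ⇒ closure, finite-bad-set form.**  If `(1 − ε)•S + ε•W ∈ N` for every `ε > 0` outside a finite set
`B`, then `S ∈ closure N`. [folklore] -/
theorem mem_closure_of_finite_bad (S W : Fin K → Matrix ι ι ℝ) (N : Set (Fin K → Matrix ι ι ℝ)) {B : Set ℝ}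
    (hB : B.Finite) (h : ∀ ε : ℝ, 0 < ε → ε ∉ B → (1 - ε) • S + ε • W ∈ N) : S ∈ closure N := by
  refine mem_closure_of_eventually_segment S W N ?_
  have h2 : ∀ᶠ ε in 𝓝[>] (0 : ℝ), 0 < ε := eventually_nhdsWithin_of_forall fun ε hε => hε
  filter_upwards [eventually_nhdsGT_not_mem_of_finite hB, h2] with ε hεB hpos
  exact h ε hpos hεB

/-- The letters of the segment: `((1 − ε)•S + ε•W) l = (1 − ε)•S l + ε•W l`. -/
theorem segment_apply (S W : Fin K → Matrix ι ι ℝ) (ε : ℝ) (l : Fin K) :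
    ((1 - ε) • S + ε • W) l = (1 - ε) • S l + ε • W l := rfl

/-- The segment stays symmetric when both ends are. [folklore] -/
theorem isSymm_segment {S W : Fin K → Matrix ι ι ℝ} (hS : ∀ l, (S l).IsSymm) (hW : ∀ l, (W l).IsSymm) (ε : ℝ)
    (l : Fin K) : (((1 - ε) • S + ε • W) l).IsSymm := by
  rw [segment_apply]
  exact ((hS l).smul _).add ((hW l).smul _)

/-! ## Finiteness of bad parameter sets -/

/-- A nonzero real polynomial has finitely many zeros. [folklore] -/
theorem finite_setOf_eval_eq_zero {p : ℝ[X]} (hp : p ≠ 0) : {ε : ℝ | p.eval ε = 0}.Finite :=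
  Polynomial.finite_setOf_isRoot hp

/-- A finite family of nonzero real polynomials has a finite joint bad set. [folklore] -/
theorem finite_setOf_exists_eval_eq_zero {α : Type*} (s : Finset α) (p : α → ℝ[X]) (hp : ∀ a ∈ s, p a ≠ 0) :
    {ε : ℝ | ∃ a ∈ s, (p a).eval ε = 0}.Finite := by
  have : {ε : ℝ | ∃ a ∈ s, (p a).eval ε = 0} = ⋃ a ∈ s, {ε : ℝ | (p a).eval ε = 0} := by
    ext ε; simp
  rw [this]
  exact Set.Finite.biUnion s.finite_toSet fun a ha => finite_setOf_eval_eq_zero (hp a ha)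

/-- **Bivariate, outer step.**  For a nonzero `R ∈ ℝ[X][X]` (outer variable `c`, coefficients polynomials in `ε`),
all but finitely many `ε` specialise `R` to a NONZERO polynomial in `c`. [folklore] -/
theorem finite_setOf_map_eval_eq_zero {R : ℝ[X][X]} (hR : R ≠ 0) :
    {ε : ℝ | R.map (evalRingHom ε) = 0}.Finite := by
  -- some coefficient of `R` is a nonzero polynomial in `ε`; where it does not vanish, the specialisation is nonzero
  have hlc : R.leadingCoeff ≠ 0 := leadingCoeff_ne_zero.mpr hR
  refine (finite_setOf_eval_eq_zero hlc).subset fun ε hε => ?_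
  simp only [Set.mem_setOf_eq] at hε ⊢
  have h := congr_arg (fun q => q.coeff R.natDegree) hε
  simpa [Polynomial.coeff_map] using h

/-- **Bivariate, inner step.**  At a good `ε`, finitely many `c` are bad. [folklore] -/
theorem finite_setOf_eval_eval_eq_zero {R : ℝ[X][X]} {ε : ℝ} (hε : R.map (evalRingHom ε) ≠ 0) :
    {c : ℝ | (R.map (evalRingHom ε)).eval c = 0}.Finite :=
  finite_setOf_eval_eq_zero hε

/-- **Choose the shift large and generic.**  Finitely many nonzero real polynomials (in `c`) and a threshold `c₀`:
some `c > c₀` is a non-zero of all of them. [folklore] -/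
theorem exists_gt_forall_eval_ne_zero {α : Type*} (s : Finset α) (q : α → ℝ[X]) (hq : ∀ a ∈ s, q a ≠ 0)
    (c₀ : ℝ) : ∃ c : ℝ, c₀ < c ∧ ∀ a ∈ s, (q a).eval c ≠ 0 := by
  classical
  have hfin := finite_setOf_exists_eval_eq_zero s q hq
  -- the bad set together with `c₀` is finite, hence bounded above; go beyond
  obtain ⟨M, hM⟩ := (hfin.insert c₀).bddAbove
  refine ⟨M + 1, ?_, fun a ha hzero => ?_⟩
  · have : c₀ ≤ M := hM (Set.mem_insert _ _)
    linarith
  · have : M + 1 ≤ M := hM (Set.mem_insert_of_mem _ ⟨a, ha, hzero⟩)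
    linarith

/-- The same with an extra finite set of FORBIDDEN values of `c` (e.g. the arc-avoidance exclusions at finitely many
osculation points). [folklore] -/
theorem exists_gt_forall_eval_ne_zero_not_mem {α : Type*} (s : Finset α) (q : α → ℝ[X]) (hq : ∀ a ∈ s, q a ≠ 0)
    {F : Set ℝ} (hF : F.Finite) (c₀ : ℝ) : ∃ c : ℝ, c₀ < c ∧ c ∉ F ∧ ∀ a ∈ s, (q a).eval c ≠ 0 := by
  classical
  have hfin := finite_setOf_exists_eval_eq_zero s q hq
  obtain ⟨M, hM⟩ := ((hfin.union hF).insert c₀).bddAbove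
  refine ⟨M + 1, ?_, fun hmem => ?_, fun a ha hzero => ?_⟩
  · have : c₀ ≤ M := hM (Set.mem_insert _ _)
    linarith
  · have : M + 1 ≤ M := hM (Set.mem_insert_of_mem _ (Or.inr hmem))
    linarith
  · have : M + 1 ≤ M := hM (Set.mem_insert_of_mem _ (Or.inl ⟨a, ha, hzero⟩))
    linarith

/-! ## The density pattern, packaged -/

/-- **Density from finitely many polynomial obstructions along a segment.**  Let `N` be a family of letter families,
`S` any letter family and `W` a witness.  Suppose there are finitely many nonzero real polynomials `p a` (`a ∈ s`)
such that `(1 − ε)•S + ε•W ∈ N` whenever `ε > 0` is a non-zero of all of them.  Then `S ∈ closure N`. [folklore] -/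
theorem mem_closure_of_polynomial_obstructions {α : Type*} (S W : Fin K → Matrix ι ι ℝ)
    (N : Set (Fin K → Matrix ι ι ℝ)) (s : Finset α) (p : α → ℝ[X]) (hp : ∀ a ∈ s, p a ≠ 0)
    (h : ∀ ε : ℝ, 0 < ε → (∀ a ∈ s, (p a).eval ε ≠ 0) → (1 - ε) • S + ε • W ∈ N) : S ∈ closure N := by
  refine mem_closure_of_finite_bad S W N (finite_setOf_exists_eval_eq_zero s p hp) fun ε hε hgood => h ε hε ?_
  intro a ha hzero
  exact hgood ⟨a, ha, hzero⟩

end Summit.ValiantsHypothesis.ValiantsHypothesis.Theorems.LacunarySymmetroidMatrixDescartes.GPDensity
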